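import Summits.CriticalPhenomena.PercolationContinuityZ3.Theorems.PercNearOneGluingNoHeavyLowerTailThreePointProductFormBoxPair

/-!
# The box theorem, one-sided form: `A = (15/8)t + (45/14)G + 15G_ψ − 30ζ − 12ε` and its exact one-step recursion
# (Sahi programme, one-child boundary-star cycle, prover prim-sahi-p2 gen 67)

Support file (`--supports stmt-CriticalPhenomena-4575`).  Standard axioms, no sorries, no named facts.  Memo
`run/shared/lean/prim/prim-sahi/FROM-prim-sahi-p2-gen67-BOX-ONESIDED.md` §0(4), §2; `prim-sahi-p2/PROOF-E3.md` §77.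

THE OBJECT.  `boxval w` (`…ProductFormBoxPair`) is the AM form `A = #P1 + #P2 − 2·#bad` of the cycle whose vertices carry the physical children
`w = [(s₁,d₁),…]`.  In the cone coordinates of LEMMA Λ (`G = (zOf v).G ≥ 0` from depth 1) and LEMMA ψ (`G_ψ = Gpsi v ≥ 0`), with `ζ = E5 = (m³)_z` and
`ε = E4`, the value is the LINEAR functional
  `A = (15/8)t + (45/14)G + 15G_ψ − 30ζ − 12ε`   (`boxval_eq_alpha`),
so the box theorem is the one-sided law `30ζ + 12ε ≤ (15/8)t + (45/14)G + 15G_ψ` on the reachable states (memo §0(4): numerically it holds with a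
factor-2 margin from depth 6; depth ≤ 5 is `boxval_nonneg_of_length_le_five`).  This file proves the EXACT ONE-STEP RECURSION of `A` under a
physical letter `(s,d)` (memo (★★)), as a polynomial identity valid for ARBITRARY states `v : StA`, `u : StB`:
  `A(N_θ(v,u)) − ((5/4)s² + (1/4)d²)·A(v,u) = −(3/2)s²t − (45/28)s²G + (5/4)d²ψ₂₃(v) + (1905/8)s²b̃ + (105/8)d²b̃ + (255/8)s²b̃₋ + (135/8)d²b̃₋`
  `  + 3(s²+d²)ε + sd·[60η₋ − 30η − 30φ_D]`
(`alpha_bstep`; `ψ₂₃(v) = 4v₁ + 23v₂`, `b̃, b̃₋, η₋` the `K_ψ` coordinates `zP v`, `η = o₁`, `φ_D = (3/4)f₁ + (37/16)f₂` the plane of `m³` read through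
`(3/4, 37/16)`).  The multiplier `(5/4)s² + (1/4)d²` removes `ζ`; `ε` enters with the good sign `3(s²+d²)ε`; the only negative even terms are
`−(3/2)s²t − (45/28)s²G`; the odd kick is `sd·W`.  Consequences recorded: the hub-letter case (`alpha_bstep_hub`), `ψ₂₃(v) ≥ 0` on the leak cone
(`psi_v_nonneg_of_inK`), and `boxval_cons` (unfolding).  [this work] (gen 67).
-/

namespace Summit.CriticalPhenomena.PercolationContinuityZ3.Theorems.ProductFormABPlus

/-- ★ `A` in cone coordinates, for arbitrary states: `α_a(v) + α_b(u) = (15/8)t + (45/14)G + 15G_ψ − 30·E5 − 12·E4`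
(`G = (zOf v).G`, `G_ψ = Gpsi v`). [this work] -/
theorem alpha_eq_cone (v : StA) (u : StB) :
    alphaA v + alphaB u = (15/8) * v.t + (45/14) * (zOf v).G + 15 * Gpsi v - 30 * u.E5 - 12 * u.E4 := by
  simp only [alphaA, alphaB, zOf, Gpsi, Lam, psi23, colM]; ring

/-- ★ The box value in cone coordinates: `boxval w = (15/8)t + (45/14)G + 15G_ψ − 30ζ − 12ε` of the state reached by `w`. [this work] -/
theorem boxval_eq_alpha (w : List (ℚ × ℚ)) :
    boxval w = (15/8) * (brunA w omegaA).t + (45/14) * (zOf (brunA w omegaA)).G + 15 * Gpsi (brunA w omegaA)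
      - 30 * (brunB w omegaB).E5 - 12 * (brunB w omegaB).E4 := by
  unfold boxval; exact alpha_eq_cone _ _

/-- Unfolding one letter: `boxval (θ :: w) = α_a(N_θ state_a(w)) + α_b(N_θ state_b(w))`. [this work] -/
theorem boxval_cons (θ : ℚ × ℚ) (w : List (ℚ × ℚ)) :
    boxval (θ :: w) = alphaA (bstepA θ.1 θ.2 (brunA w omegaA)) + alphaB (bstepB θ.1 θ.2 (brunB w omegaB)) := by
  rfl

/-- ★★ THE EXACT ONE-STEP RECURSION of `A` under a physical letter `(s,d)` (memo (★★)), for ARBITRARY states: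
`A(N_θ(v,u)) − ((5/4)s² + (1/4)d²)·A(v,u) = −(3/2)s²t − (45/28)s²G + (5/4)d²(4v₁+23v₂) + (1905/8)s²b̃ + (105/8)d²b̃ + (255/8)s²b̃₋ + (135/8)d²b̃₋`
`+ 3(s²+d²)E4 + sd·[60η₋ − 30·o₁ − 30((3/4)f₁ + (37/16)f₂)]` — `ζ = E5` does not appear on the right. [this work] -/
theorem alpha_bstep (s d : ℚ) (v : StA) (u : StB) :
    (alphaA (bstepA s d v) + alphaB (bstepB s d u)) - ((5/4) * s ^ 2 + (1/4) * d ^ 2) * (alphaA v + alphaB u) =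
      -(3/2) * s ^ 2 * v.t - (45/28) * s ^ 2 * (zOf v).G + (5/4) * d ^ 2 * (4 * (zOf v).v₁ + 23 * (zOf v).v₂)
      + (1905/8) * s ^ 2 * (zP v).b + (105/8) * d ^ 2 * (zP v).b + (255/8) * s ^ 2 * (zP v).bm + (135/8) * d ^ 2 * (zP v).bm
      + 3 * (s ^ 2 + d ^ 2) * u.E4
      + s * d * (60 * (zP v).η - 30 * v.o1 - 30 * ((3/4) * u.f1 + (37/16) * u.f2)) := by
  simp only [alphaA, alphaB, bstepA, bstepB, combA, combB, stepA, stepB, zOf, zP, Lam, colM]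
  ring

/-- The hub-letter case (`d = 0`): `A(N_{(s,0)}(v,u)) = (5/4)s²·A(v,u) + s²·[−(3/2)t − (45/28)G + (1905/8)b̃ + (255/8)b̃₋ + 3·E4]`. [this work] -/
theorem alpha_bstep_hub (s : ℚ) (v : StA) (u : StB) :
    alphaA (bstepA s 0 v) + alphaB (bstepB s 0 u) =
      (5/4) * s ^ 2 * (alphaA v + alphaB u)
      + s ^ 2 * (-(3/2) * v.t - (45/28) * (zOf v).G + (1905/8) * (zP v).b + (255/8) * (zP v).bm + 3 * u.E4) := by
  have h := alpha_bstep s 0 v u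
  simp only [zero_pow two_ne_zero, mul_zero, zero_mul, add_zero] at h
  linarith

/-- On the leak cone `K_ℚ` the functional `ψ₂₃(v) = 4v₁ + 23v₂` is nonnegative (`= 4·ã₋ + (39/2)·v₂` with `ã₋ = v₁ + (7/8)v₂ ≥ 0`, `v₂ ≥ 0`), so the
`d²`-term `(5/4)d²ψ₂₃(v)` of `alpha_bstep` is nonnegative on every state reached by a nonempty physical word. [this work] -/
theorem psi_v_nonneg_of_inK (z : Z5) (h : inK z) : 0 ≤ 4 * z.v₁ + 23 * z.v₂ := by
  obtain ⟨_, h2, h3, _⟩ := h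
  linarith

/-- The `d²`-coefficient functional is nonnegative along nonempty physical words. [this work] -/
theorem psi_v_nonneg_brun (w : List (ℚ × ℚ)) (hw : ∀ θ ∈ w, 0 ≤ θ.1 + θ.2 ∧ 0 ≤ θ.1 - θ.2) (hne : w ≠ []) :
    0 ≤ 4 * (zOf (brunA w omegaA)).v₁ + 23 * (zOf (brunA w omegaA)).v₂ :=
  psi_v_nonneg_of_inK _ (inK_brun w hw hne)

/-- The even `s²`-terms `(1905/8)b̃ + (255/8)b̃₋` of `alpha_bstep` are nonnegative along physical words (`b̃ ≥ 0` and `b̃₋ ≥ −b̃/4` on `K_ψ`). [this work] -/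
theorem bterms_nonneg_brun (w : List (ℚ × ℚ)) (hw : ∀ θ ∈ w, 0 ≤ θ.1 + θ.2 ∧ 0 ≤ θ.1 - θ.2) :
    0 ≤ (1905/8) * (zP (brunA w omegaA)).b + (255/8) * (zP (brunA w omegaA)).bm := by
  obtain ⟨_, h2, h3, _⟩ := inKP_brun w hw
  linarith

/-- ★ COROLLARY (the recursion as an inequality along physical words).  For a physical letter `(s,d)` applied to the state of a NONEMPTY physical
word `w`:  `boxval ((s,d) :: w) ≥ ((5/4)s² + (1/4)d²)·boxval w − (3/2)s²t − (45/28)s²G + 3(s²+d²)ε − |odd kick|`, in the exact form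
`boxval ((s,d) :: w) − ((5/4)s² + (1/4)d²)·boxval w + (3/2)s²t + (45/28)s²G − 3(s²+d²)E4 − sd·W ≥ 0`
(all the dropped terms `(5/4)d²ψ₂₃(v)`, `(1905/8)s²b̃ + (255/8)s²b̃₋`, `(105/8)d²b̃ + (135/8)d²b̃₋` are `≥ 0`). [this work] -/
theorem boxval_cons_ge (s d : ℚ) (w : List (ℚ × ℚ)) (hw : ∀ θ ∈ w, 0 ≤ θ.1 + θ.2 ∧ 0 ≤ θ.1 - θ.2) (hne : w ≠ []) :
    0 ≤ boxval ((s, d) :: w) - ((5/4) * s ^ 2 + (1/4) * d ^ 2) * boxval w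
      + (3/2) * s ^ 2 * (brunA w omegaA).t + (45/28) * s ^ 2 * (zOf (brunA w omegaA)).G
      - 3 * (s ^ 2 + d ^ 2) * (brunB w omegaB).E4
      - s * d * (60 * (zP (brunA w omegaA)).η - 30 * (brunA w omegaA).o1
          - 30 * ((3/4) * (brunB w omegaB).f1 + (37/16) * (brunB w omegaB).f2)) := by
  have h := alpha_bstep s d (brunA w omegaA) (brunB w omegaB)
  have hψ := psi_v_nonneg_brun w hw hne
  obtain ⟨_, hb, hbm, _⟩ := inKP_brun w hw
  rw [boxval_cons]
  unfold boxval
  nlinarith [mul_nonneg (sq_nonneg d) hψ, mul_nonneg (sq_nonneg s) hb, mul_nonneg (sq_nonneg d) hb,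
    mul_nonneg (sq_nonneg s) (show 0 ≤ (1/4) * (zP (brunA w omegaA)).b + (zP (brunA w omegaA)).bm by linarith),
    mul_nonneg (sq_nonneg d) (show 0 ≤ (1/4) * (zP (brunA w omegaA)).b + (zP (brunA w omegaA)).bm by linarith)]

end Summit.CriticalPhenomena.PercolationContinuityZ3.Theorems.ProductFormABPlus
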